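import Literature.AnabelianGeometry.EtaleTheta.Discharge.Sec4Prop42SubUnitRoots
import Literature.AlgebraicGeometry.Frobenioids.PadicKummerSetting
import HarnessLib

/-!
# [EtTh] Prop. 4.2 (iv), sub-node L05 `UnitRootsUpstairs` AT AN ARBITRARY PAIR (domain `A` in place of `A_⊙`):
# the transport half PROVED, the roots-of-constants law over `A` as the only input; its Def. 2.2 reading

S. Mochizuki, *The étale theta function and its Frobenioid-theoretic manifestations*, Publ. RIMS **45** (2009)
[MochizukiEtTh2009], §4, Prop. 4.2 (iv), proof PDF p.90 (printed p.316) L14–17: «it follows from the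
"(N, H_⊙, f|_{A_N})-saturated-ness" condition in the statement of assertion (iii) [cf. also Proposition 3.4, (ii)]
that the pull-back `∈ O^×(A_N)` or `∈ O^×(Ā_N)` of any element `∈ O^×(A_⊙)` [i.e., via the "pull-back portion" of
`α, ᾱ` — cf. Definition 4.1, (iv), (d)] admits an `N`-th root». [cite: MochizukiEtTh2009, Prop 4.2 p.90]

abc-iut cell, layer L2, DAG node `EtTh:Prop4.2(iv)`, plan/L2/SUBDAG-EtTh-Prop42.md row L05; seat abc-iut-w4-d044
(gen 4).  WANTED by abc-iut-L2-t4 g6 (R480 SHAPES 16:37:28Z, the domain-agnostic port 'Prop42_iv_iso' of [EtTh]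
Prop. 4.2 (iv) across an isomorphism of pairs, consumer abc-iut-w6-d077 g6 '_final_v3'): its binder **`h₅` = L05 AT
THE PAIR** — for an `N`-th root `R` of a fraction-pair with ARBITRARY domain `A` (the typed row
`Prop42Sub.UnitRootsUpstairs` fixes `A = A_⊙`): «every unit `x'` of `A_N` lying over a unit `x` of `A` along the
pull-back part `α'` of `α` is an `N`-th power in `O^×(A_N)`».  PROOF-ONLY (0 defs, no instance, no new `Prop` fact;
nothing landed is edited): this lineage's `unitRootsUpstairs_of_constantRoots` (p420977) ported VERBATIM from
`A_⊙` to `A`.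
* `Prop42Sub.unitRootsUpstairsAt_of_constantRootsAt` — **`h₅` at every root with domain `A` ⟸ the
  roots-of-constants law OVER `A`** («for a Frobenius-trivial `(N, H_⊙^{bs-fld})`-saturated `A″` and
  `g : A″^bs → A^bs`, every `Div_B`-trivial `ξ ∈ B(A^bs)` acquires an `N`-th root in `B(A″^bs)` along `g`»; at
  `A = A_⊙` this is GAP row G-w4d044-1 verbatim), modulo `Φ` divisorial and `B` group-like: the TRANSPORT half of
  p.90 L14–17 in the model Frobenioid ([FrdI] Thm. 5.2 (ii): `O^×(−) ↪ B(Base −)` as the `Div_B`-trivial part;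
  Def. 4.1 (iii)(a) pre-steps `A₁ → A_N`, `A₁ → A″`; torsion-freeness of `Φ^gp`).
* `Prop42Sub.unitRootsUpstairsAt_of_unitRootsUpstairs` — at `A = A_⊙` the binder is the typed row's instance.
* `Prop42Sub.constantRootsAt_of_def22Reading` / `unitRootsUpstairsAt_of_def22Reading` — the law over `A` AT THE
  FAITHFUL [FrdII] Def. 2.2 (ii) READING of the saturation slot (context family `ctx`, reading law `hNH`, as in
  abc-iut-w6-d047's `BiKummerThm44SubNHSatDef22.lean` and this lineage's `Sec4Prop42SubLawsOfDef22Reading.lean`):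
  ⟸ [FrdII] Rmk. 2.2.1 `PadicKummer.SaturatedInvariantsAdmitRoots (ctx A″) N` for the Frobenius-trivial `A″`
  over `A` (layer L1, PROVED at the arithmetic contexts) + the root-free hull clause «pull-backs to `A″` of
  `Div_B`-trivial elements of `B(A^bs)` are images of `(H_⊙)_{A″}`-invariant elements of `O^□(A″)`» ([FrdII]
  Rmk. 2.2.1 «`O^□(A)^H ⥲ O^□(L^H)`» + [EtTh] Prop. 3.4 (ii); for `A` over `A_⊙` its constants lie in the
  `H_⊙^{bs-fld}`-fixed field).
* `unitRootsUpstairsAt_mkOfModelCanonical_of_constantRootsAt` — the canonical model instance (`B` group-like is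
  `T.isUnit_BΛ`; residual: `Φ` divisorial + the law over `A`).
HONEST FRAMING: [EtTh]/[FrdII] are refereed prerequisites; typed ≠ proved for the law binder; nothing here bears on,
or takes a side on, the disputed [IUTchIII] Cor. 3.12.
-/

namespace Literature.AnabelianGeometry.EtaleTheta

open CategoryTheory Opposite Literature.AlgebraicGeometry.Frobenioids

universe u₀ v₀ u v w

variable {K : Type u₀} [Field K]

namespace BiKummerSetting

variable {X : SemiGraphs.TemperedArithmeticGroup.{u₀} K} {D₀ : Type u₀} [Category.{v₀} D₀]
  {V : FrdIMonoidStub.{w}} {T : RealifiedDivisorMonoids (D₀ := D₀) V} {D : Type u} [Category.{v} D]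
  {VD : FrdICatStub.{u, v, w} D} (S : BiKummerSetting X T D VD)

namespace Prop42Sub

variable (pullFrac : ∀ {A A' : S.C} (_ : A' ⟶ A), S.biratUnits A → S.biratUnits A')

/-- **L05 AT THE PAIR (domain `A`) ⟸ the roots-of-constants law over `A`** (modulo `Φ` divisorial, `B`
group-like): for every fraction-pair with domain `A`, every `N`-th root `R` and units `x ∈ O^×(A)`, `x' ∈ O^×(A_N)`
with `x' ∘ α' = α' ∘ x`, there is `y ∈ O^×(A_N)` with `yᴺ = x'`.  Transport half of p.90 L14–17 in the model
Frobenioid: `u_{x'} = Base(α')^* u_x` (pull-back property of `α'`), the law at the `(N, H_⊙^{bs-fld})`-saturated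
`A″` of Def. 4.1 (iii)(a) along `Base(s₂)⁻¹ ≫ Base(s₁) ≫ Base(α')`, transport back, `Div_B = 0` by
torsion-freeness of `Φ^gp`, injectivity of `O^×(A_N) → B(Base A_N)` — abc-iut-w4-d044's p420977 proof with `A_⊙`
replaced by `A`. [cite: MochizukiEtTh2009, Prop 4.2 p.90] -/
theorem unitRootsUpstairsAt_of_constantRootsAt
    (hΦd : Objectwise (fun M _ => IsDivisorial M) S.tf.divisorMonoid)
    (hBg : Objectwise (fun M _ => IsGroupLike M) S.tf.ratFnFunctor) {A : S.C}
    (hL : ∀ (A'' : S.C) (N : ℕ+) (g : A''.base ⟶ A.base) (ξ : S.tf.ratFnFunctor.obj (op A.base)),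
      S.IsFrobeniusTrivial A'' → S.IsNHSaturatedBsFld S.HodotBsFld A'' N →
      divB S.tf.divisorMonoid S.tf.ratFnFunctor S.tf.divBNatTrans (op A.base) ξ = 1 →
        ∃ ζ : S.tf.ratFnFunctor.obj (op A''.base), ζ ^ (N : ℕ) = pull S.tf.ratFnFunctor g ξ)
    {B : S.C} (f : S.biratUnits A) (P : S.FractionPair f B) (N : ℕ+) (R : S.NthRoot f P N pullFrac) :
    ∀ (x : Aut A) (x' : Aut R.AN), x ∈ S.units A → x' ∈ S.units R.AN →
      x'.hom ≫ R.αData.α₁ = R.αData.α₁ ≫ x.hom → ∃ y ∈ S.units R.AN, y ^ (N : ℕ) = x' := by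
  intro x x' hx hx' hover
  -- Def. 4.1 (iii)(a) for `A_N`: pre-steps `s₁ : A₁ → A_N`, `s₂ : A₁ → A''`
  obtain ⟨A₁, A'', s₁, s₂, hs₁, hs₂, hft, hNH⟩ := R.isSaturated.cond_a
  haveI : IsIso (ModelFrobenioid.baseMap s₁) := hs₁.2
  haveI : IsIso (ModelFrobenioid.baseMap s₂) := hs₂.2
  have hxm : x ∈ ModelFrobenioid.units A := ⟨hx.1, hx.2⟩
  have hx'm : x' ∈ ModelFrobenioid.units R.AN := ⟨hx'.1, hx'.2⟩
  -- integrality / cancellation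
  have hint : IsIntegral (S.tf.divisorMonoid.obj (op R.AN.base)) := (hΦd R.AN.base).isPreDivisorial.isIntegral
  haveI : IsCancelMul (S.tf.ratFnFunctor.obj (op R.AN.base)) :=
    isIntegral_iff_isCancelMul.mp (hBg R.AN.base).isPreDivisorial.isIntegral
  -- the unit `ξ := u_x` of `A`, with `Div_B(ξ) = 0`
  set ξ := ModelFrobenioid.unit x.hom with hξ_def
  have hξ : divB S.tf.divisorMonoid S.tf.ratFnFunctor S.tf.divBNatTrans (op A.base) ξ = 1 :=
    ModelFrobenioid.divB_unitsToRatFn_eq_one (hΦd A.base).isSharp ⟨x, hxm⟩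
  -- `x'` lies over `x` along `α'`: `u_{x'} = Base(α')^* ξ`
  have hp₁ := ModelFrobenioid.degFr_div_of_isPullbackMorphism hΦd R.αData.cond_d
  have hux' : ModelFrobenioid.unit x'.hom =
      pull S.tf.ratFnFunctor (ModelFrobenioid.baseMap R.αData.α₁) ξ := by
    have h := congrArg ModelFrobenioid.unit hover
    rw [ModelFrobenioid.unit_comp_pull, ModelFrobenioid.unit_comp_pull, hx'm.1, pull_id, hp₁.1,
      hxm.2, PNat.one_coe, pow_one, pow_one, mul_comm] at h
    exact mul_right_cancel h
  -- the law at `A''` along `g := Base(s₂)⁻¹ ≫ Base(s₁) ≫ Base(α')`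
  let b₁ := ModelFrobenioid.baseMap s₁
  let b₂ := ModelFrobenioid.baseMap s₂
  obtain ⟨ζ, hζ⟩ := hL A'' N (inv b₂ ≫ b₁ ≫ ModelFrobenioid.baseMap R.αData.α₁) ξ hft hNH hξ
  -- transport `ζ` to `B(Base A_N)`: `w := Base(s₁)⁻¹^* Base(s₂)^* ζ`, with `w^N = u_{x'}`
  set w : S.tf.ratFnFunctor.obj (op R.AN.base) :=
    pull S.tf.ratFnFunctor (inv b₁) (pull S.tf.ratFnFunctor b₂ ζ) with hw_def
  have hwN : w ^ (N : ℕ) = ModelFrobenioid.unit x'.hom := by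
    rw [hw_def, ← map_pow, ← map_pow, hζ, ← pull_comp, ← pull_comp, Category.assoc,
      IsIso.hom_inv_id_assoc, IsIso.inv_hom_id_assoc, hux']
  -- `Div_B(w) = 0` (torsion-freeness of `Φ^gp`)
  have hdw : divB S.tf.divisorMonoid S.tf.ratFnFunctor S.tf.divBNatTrans (op R.AN.base) w = 1 := by
    apply gp_pow_injective_of_isDivisorial (hΦd R.AN.base) N
    rw [one_pow, ← map_pow, hwN]
    exact ModelFrobenioid.divB_unitsToRatFn_eq_one (hΦd R.AN.base).isSharp ⟨x', hx'm⟩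
  -- the unit `y := (1, id, 0, w)` of `A_N`
  obtain ⟨wu, hwu⟩ := (hBg R.AN.base).isUnit w
  have h1 : Algebra.GrothendieckGroup.of (1 : S.tf.divisorMonoid.obj (op R.AN.base)) =
      divB S.tf.divisorMonoid S.tf.ratFnFunctor S.tf.divBNatTrans (op R.AN.base) w := by
    rw [map_one, hdw]
  have h1' : Algebra.GrothendieckGroup.of (1 : S.tf.divisorMonoid.obj (op R.AN.base)) =
      divB S.tf.divisorMonoid S.tf.ratFnFunctor S.tf.divBNatTrans (op R.AN.base) ↑wu⁻¹ := by
    have h : divB S.tf.divisorMonoid S.tf.ratFnFunctor S.tf.divBNatTrans (op R.AN.base) ↑wu⁻¹ *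
        divB S.tf.divisorMonoid S.tf.ratFnFunctor S.tf.divBNatTrans (op R.AN.base) w = 1 := by
      rw [← map_mul, ← hwu, Units.inv_mul, map_one]
    rw [hdw, mul_one] at h
    rw [map_one, h]
  let y : Aut R.AN := ModelFrobenioid.unitAut R.AN 1 1 w ↑wu⁻¹ h1 h1' (mul_one 1)
    (by rw [← hwu, Units.inv_mul])
  have hy : y ∈ ModelFrobenioid.units R.AN := ModelFrobenioid.unitAut_mem_units _ _ _ _ _ _ _ _ _
  refine ⟨y, ⟨hy.1, hy.2⟩, ?_⟩
  -- `yᴺ = x'`: both are units of `A_N` with the same image `wᴺ = u_{x'}` in `B(Base A_N)`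
  have hinj := ModelFrobenioid.unitsToRatFn_injective (X := R.AN) hint
  have key : (⟨y, hy⟩ : ModelFrobenioid.units R.AN) ^ (N : ℕ) = ⟨x', hx'm⟩ := by
    apply hinj
    apply Units.ext
    rw [map_pow, Units.val_pow_eq_pow_val, ModelFrobenioid.coe_unitsToRatFn,
      ModelFrobenioid.coe_unitsToRatFn]
    exact hwN
  exact congrArg Subtype.val key

/-- At the setting's own domain `A = A_⊙` the binder `h₅` is the instance of the typed row
`Prop42Sub.UnitRootsUpstairs` at the root `R`. [cite: MochizukiEtTh2009, Prop 4.2 p.90] -/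
theorem unitRootsUpstairsAt_of_unitRootsUpstairs (h : UnitRootsUpstairs S pullFrac)
    {B : S.C} (f : S.biratUnits S.Aodot) (P : S.FractionPair f B) (N : ℕ+) (R : S.NthRoot f P N pullFrac) :
    ∀ (x : Aut S.Aodot) (x' : Aut R.AN), x ∈ S.units S.Aodot → x' ∈ S.units R.AN →
      x'.hom ≫ R.αData.α₁ = R.αData.α₁ ≫ x.hom → ∃ y ∈ S.units R.AN, y ^ (N : ℕ) = x' :=
  fun x x' hx hx' hover => h f P N R x x' hx hx' hover

/-! ### The roots-of-constants law over `A` at the faithful [FrdII] Def. 2.2 (ii) reading -/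

/-- **The roots-of-constants law OVER `A` AT THE Def. 2.2 READING ⟸ [FrdII] Rmk. 2.2.1 + a root-free hull clause**
(the shape of this lineage's `constantRoots_of_def22Reading`, `A_⊙` replaced by `A`): reading law `hNH` (the
setting's saturation slot implies Def. 2.2 (ii) saturation of the context `ctx A″`), Rmk. 2.2.1's named fact
`PadicKummer.SaturatedInvariantsAdmitRoots (ctx A″) N` for the Frobenius-trivial `A″` over `A` (`h221`; PROVED at
the arithmetic contexts, layer L1), a monoid map `ιO A″ : O^□(A″) → B(A″^bs)` and the clause `hconst` «the
pull-back to `A″` of a `Div_B`-trivial element of `B(A^bs)` is the image of an `(H_⊙)_{A″}`-invariant element».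
[cite: MochizukiEtTh2009, Prop 4.2 p.90] -/
theorem constantRootsAt_of_def22Reading {A : S.C} (ctx : S.C → PadicKummer.Def22Context)
    (hNH : ∀ (A'' : S.C) (N : ℕ+),
      S.IsNHSaturatedBsFld S.HodotBsFld A'' N → PadicKummer.IsNHSaturated (ctx A'') N)
    (h221 : ∀ (A'' : S.C) (N : ℕ+), (A''.base ⟶ A.base) → S.IsFrobeniusTrivial A'' →
      PadicKummer.SaturatedInvariantsAdmitRoots (ctx A'') N)
    (ιO : ∀ A'' : S.C, (ctx A'').O →* S.tf.ratFnFunctor.obj (op A''.base))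
    (hconst : ∀ (A'' : S.C) (g : A''.base ⟶ A.base) (ξ : S.tf.ratFnFunctor.obj (op A.base)),
      S.IsFrobeniusTrivial A'' →
      divB S.tf.divisorMonoid S.tf.ratFnFunctor S.tf.divBNatTrans (op A.base) ξ = 1 →
        ∃ f : (ctx A'').O, (∀ h : (ctx A'').HA, (h : (ctx A'').AutE) • f = f) ∧
          ιO A'' f = pull S.tf.ratFnFunctor g ξ) :
    ∀ (A'' : S.C) (N : ℕ+) (g : A''.base ⟶ A.base) (ξ : S.tf.ratFnFunctor.obj (op A.base)),
      S.IsFrobeniusTrivial A'' → S.IsNHSaturatedBsFld S.HodotBsFld A'' N →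
      divB S.tf.divisorMonoid S.tf.ratFnFunctor S.tf.divBNatTrans (op A.base) ξ = 1 →
        ∃ ζ : S.tf.ratFnFunctor.obj (op A''.base), ζ ^ (N : ℕ) = pull S.tf.ratFnFunctor g ξ := by
  intro A'' N g ξ hft hsat hξ
  obtain ⟨f, hf, hfe⟩ := hconst A'' g ξ hft hξ
  obtain ⟨r, hr⟩ := h221 A'' N g hft (hNH A'' N hsat) f hf
  exact ⟨ιO A'' r, by rw [← map_pow, hr, hfe]⟩

/-- **L05 AT THE PAIR (domain `A`) AT THE Def. 2.2 READING** (modulo `Φ` divisorial, `B` group-like): the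
transport `unitRootsUpstairsAt_of_constantRootsAt` fed by `constantRootsAt_of_def22Reading`.
[cite: MochizukiEtTh2009, Prop 4.2 p.90] -/
theorem unitRootsUpstairsAt_of_def22Reading
    (hΦd : Objectwise (fun M _ => IsDivisorial M) S.tf.divisorMonoid)
    (hBg : Objectwise (fun M _ => IsGroupLike M) S.tf.ratFnFunctor) {A : S.C}
    (ctx : S.C → PadicKummer.Def22Context)
    (hNH : ∀ (A'' : S.C) (N : ℕ+),
      S.IsNHSaturatedBsFld S.HodotBsFld A'' N → PadicKummer.IsNHSaturated (ctx A'') N)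
    (h221 : ∀ (A'' : S.C) (N : ℕ+), (A''.base ⟶ A.base) → S.IsFrobeniusTrivial A'' →
      PadicKummer.SaturatedInvariantsAdmitRoots (ctx A'') N)
    (ιO : ∀ A'' : S.C, (ctx A'').O →* S.tf.ratFnFunctor.obj (op A''.base))
    (hconst : ∀ (A'' : S.C) (g : A''.base ⟶ A.base) (ξ : S.tf.ratFnFunctor.obj (op A.base)),
      S.IsFrobeniusTrivial A'' →
      divB S.tf.divisorMonoid S.tf.ratFnFunctor S.tf.divBNatTrans (op A.base) ξ = 1 →
        ∃ f : (ctx A'').O, (∀ h : (ctx A'').HA, (h : (ctx A'').AutE) • f = f) ∧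
          ιO A'' f = pull S.tf.ratFnFunctor g ξ)
    {B : S.C} (f : S.biratUnits A) (P : S.FractionPair f B) (N : ℕ+) (R : S.NthRoot f P N pullFrac) :
    ∀ (x : Aut A) (x' : Aut R.AN), x ∈ S.units A → x' ∈ S.units R.AN →
      x'.hom ≫ R.αData.α₁ = R.αData.α₁ ≫ x.hom → ∃ y ∈ S.units R.AN, y ^ (N : ℕ) = x' :=
  unitRootsUpstairsAt_of_constantRootsAt S pullFrac hΦd hBg
    (constantRootsAt_of_def22Reading S ctx hNH h221 ιO hconst) f P N R

end Prop42Sub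

/-! ### The canonical model instance -/

section Canonical

variable (X) (tf : TemperedFrobenioid T D VD) (hZ : tf.monoidType = MonoidType.Z)
  (hP : ∀ A : Dᵒᵖ, IsPerfect (tf.Φ.carrier A)) (IG : D → Prop) (gS : ∀ A : D, IG A → (X.Pi →* Aut A))
  (gSs : ∀ (A : D) (h : IG A), Function.Surjective (gS A h))
  (NH : Subgroup (Field.absoluteGaloisGroup K) → tf.category → ℕ+ → Prop) (A₀ : tf.category)
  (hA₀ : PreFrobenioid.IsFrobeniusTrivial tf.toElem A₀) (hA₀' : IG A₀.base)

/-- **L05 AT THE PAIR for the CANONICAL MODEL INSTANCE** (model transport `pullFracModel`; `B` group-like is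
`T.isUnit_BΛ`): modulo `Φ` divisorial and the roots-of-constants law over the domain `A` for the chosen
saturation predicate `NH`. [cite: MochizukiEtTh2009, Prop 4.2 p.90] -/
theorem unitRootsUpstairsAt_mkOfModelCanonical_of_constantRootsAt
    (hΦd : Objectwise (fun M _ => IsDivisorial M) tf.divisorMonoid) {A : tf.category}
    (hL : ∀ (A'' : tf.category) (N : ℕ+) (g : A''.base ⟶ A.base) (ξ : tf.ratFnFunctor.obj (op A.base)),
      PreFrobenioid.IsFrobeniusTrivial tf.toElem A'' →
      NH (mkOfModelCanonical X tf hZ hP IG gS gSs NH A₀ hA₀ hA₀').HodotBsFld A'' N →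
      divB tf.divisorMonoid tf.ratFnFunctor tf.divBNatTrans (op A.base) ξ = 1 →
        ∃ ζ : tf.ratFnFunctor.obj (op A''.base), ζ ^ (N : ℕ) = pull tf.ratFnFunctor g ξ)
    {B : tf.category} (f : tf.biratUnitsModel A)
    (P : (mkOfModelCanonical X tf hZ hP IG gS gSs NH A₀ hA₀ hA₀').FractionPair f B) (N : ℕ+)
    (R : (mkOfModelCanonical X tf hZ hP IG gS gSs NH A₀ hA₀ hA₀').NthRoot f P N (fun φ x => tf.pullFracModel φ x)) :
    ∀ (x : Aut A) (x' : Aut R.AN), x ∈ tf.units A → x' ∈ tf.units R.AN →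
      x'.hom ≫ R.αData.α₁ = R.αData.α₁ ≫ x.hom → ∃ y ∈ tf.units R.AN, y ^ (N : ℕ) = x' :=
  Prop42Sub.unitRootsUpstairsAt_of_constantRootsAt (mkOfModelCanonical X tf hZ hP IG gS gSs NH A₀ hA₀ hA₀')
    (fun φ x => tf.pullFracModel φ x) hΦd (tf.isGroupLike_ratFnFunctor T.isUnit_BΛ) hL f P N R

end Canonical

end BiKummerSetting

end Literature.AnabelianGeometry.EtaleTheta
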